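/-
Origin: expansion seat `planner-pub-hodgecm-mc-axioms-1-g14-0`, handover #W119 2026-08-20T15:53:55Z md5 4aa8e6993513 (PKG 92fc7060f3db → 4aa8e6993513; 597 l.; MECHANICAL (iib-R) rewrite v3.1 of the PKG file as it stands (49 token edits; rules R1x3+RX[h₂']x46)) (`HOME/mc/pub-hodgecm-mc-axioms-1-g14/revendor/kit-r55/stage55/HodgeCM/Model/ArchKTypeOfSA.lean`, md5 4aa8e6993513, 597 lines);
landed by the gen-22 packager (p-g22) in gate run 55 REPLACES the earlier landed copy of `HodgeCM/Model/ArchKTypeOfSA.lean` (seat copy carried the packager Origin header of an earlier run (stripped)).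
-/
/-
Copyright (c) 2026. Released under Apache 2.0 license as described in the file LICENSE.
Cell pub-hodgecm, MODEL layer (construction prover mc-carch-1, gen 3), BINDER-OWNERS rows 12/14/15: E's data binder `C` CUT AT THE TOTAL
S FAMILY `SInstance.SA` for the canonical representatives `ι₁ = (InfinitePlace.mk ι₁).embedding` (ruling of record (ORIENT-h)/(TWIST-2),
lead 2026-08-20T04:17:04Z: remedy (o) at the ι₁-read bit `orientBitι`, residual (TWIST-2) routed (c̄)-first / (m) fallback — this file is the
id-branch half under (m) and the whole of rows 12/14/15 under (c̄)).
-/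
import Summits.HodgeConjecture.HodgeCM.Model.ArchKTypeOfOrient
import Summits.HodgeConjecture.HodgeCM.Model.ThetaAdelicSideInstanceA

/-!
# `C` at `SA` for canonical representatives: `archKTypeOfSA`, rows 14/15 for it hypothesis-free

For E's pins of record `S := SInstance.SA @hGR @η @hη @hηc @hGR₀ @hGR₁ @hGR₂ @hGR₃ @μ @𝔄` (sinst-1 `Model/ThetaAdelicSideInstanceA`, the total
honest S family at theta-3's archimedean line datum `𝔄`), at a context `(V, c)` with

* `hemb : (InfinitePlace.mk ι₁).embedding = ι₁` — the CANONICAL representative of the place (the id branch of #CA16 `Model/ArchKTypeOfOrient`;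
  under ruling (c̄) E consumes its archimedean binders only there);
* `hc : SignRecipe.GoodCtx (orientBitι L ι₁) ι₁ c` — a good context of the ORIENTED recipe bit of record (#CA16 `orientBitι`; E's model guard
  `(thetaModelOf[O] …).GoodCtx ι₁ c` gives it through the census bridge of glue-1's (o) chain, `thetaModelO_goodCtx_iff`),

the four context lines read POSITIVE at `v₁` (`hpos_dW…_SA`, from #CA16 `hpos_iff_eq_orientBitι_of_goodCtx_of_embedding_eq`), so the literal
slot `(Unit, Empty)` applies with theta-3's bijections `eR := posIdxEquivUnit _`, `eS := negIdxEquivEmpty _` ((F1) `Model/ArchLineDatumOf`),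
and this file BUILDS

  `archKTypeOfSAZero/One … : ArchKTypeData (thetaSpaceInputIn hHD hI h₁ h₃ (SInstance.SA … V c) hV) k N`   (k = 0, 1),
  `archKTypeOfSA … k hk` (E's `k = 0 ∨ k = 1` dispatch)

by transporting #CA14's `archKTypeOfSlot{Zero,One}Rec` along `SA_eq_archSideOf_of_goodCtx` (`ArchKTypeData.castSide`), with TWO former inputs
DISCHARGED: `hlevel` (= theta-3's installed pin lemma `ThetaAdelicSide.exists_corrector_of_mem_levelImage`, for EVERY side and level) and
`hsec` (= #CA13 `hsec_of_embedding_eq hemb`).  ROWS 14/15 for these terms are HYPOTHESIS-FREE (`isWeaklyPDiff_archKTypeOfSA`,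
`isPMinusKilledAlong_archKTypeOfSA` in `_r20AE`'s Along shape), transported from #CA14 `…_of_embedding_eq` by `castSide` invariance.

REMAINING INPUTS (each a statement about honest objects at `(V, c, k, N)`, in its owner's currency):
* `Γ₀ : Level V` — the level at which line `k`'s classes are supplied (to be the deep congruence level of (D-2));
* `arch₀ₖ : linePhi V dₖ … hposₖ = (𝔄 V c).Φinf k` — the datum's test vector of line `k` IS the literal-slot degree-one vector (`rfl` at
  theta-3's (F1) `archLineDatumOf`, `dif_pos` read-back at (T) `archLineDatumTotal`);
* `harchₖ` ((c5): the compact archimedean factors at the definite places fix `φ_N(Φ_∞(ℓ))` — (S-norm) on `η`'s type there);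
* `hfinₖ` ((D-2): `Γ₀.K` fixes every `φ_N(Φ_∞)` — deep-level fixing, tree `UnitaryDualPairSeesawCMLinesDeepLevelFixed`);
* `hχₖ` ((S-norm) at `v₁`: `c_k(u) · det A(u)^{e_P} · d(u)^{e_Q} = d̄(u)` on `Stab(x₀)` at the exponent tuple of record).
Nothing is cited and nothing is minted: terms of an existing structure and kernel lemmas over installed RUN-39 modules + #CA16; 0 records,
0 `def … : Prop`.
-/

set_option autoImplicit false

noncomputable section

open Filter Topology Complex
open NumberField NumberField.InfinitePlace NumberField.mixedEmbedding IsDedekindDomain MeasureTheory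
open scoped Matrix TensorProduct Classical SchwartzMap
open MulAction
open Literature.Geometry.ComplexHyperbolic.BallModel (U21 x₀ stabilizerEquivK21)
open Literature.NumberTheory.Automorphic.U21 (K21 matA sclD)
open Literature.AlgebraicGeometry.HodgeTheory
open Literature.AlgebraicGeometry.ShimuraVarieties Literature.AlgebraicGeometry.ShimuraVarieties.BallForms
open Literature.NumberTheory.Automorphic Literature.NumberTheory.Weil1964
open Literature.RepresentationTheory.KonnoKonno2007 Literature.RepresentationTheory.KonnoKonno2007.RealDualPair
open Literature.NumberTheory.GelbartRogawski1991 Literature.NumberTheory.GelbartRogawski1991.UnitaryDualPair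
open Literature.Analysis.SegalBargmann Literature.Analysis.Distribution
open Literature.NumberTheory.Automorphic.PicardCM
open HodgeCM.Adelic HodgeCM.PerL34 HodgeCM.Model.HypCensus HodgeCM.Model.SupplyInstance HodgeCM.Model.ArchSideTerm

namespace HodgeCM.Model

/-! ## § 0 Two generic facts: `hlevel` for every side, (REP)-Along under `castSide` -/

section Generic

variable (hHD : exists_isReal_hodgeModel) (hI : hodgePQ_independent_of_hodgeModel)
  (h₁ : BallQuotientUniformised)  (h₃ : CMAbelianVarietyRealised)
variable {L : CMField} {ι₁ : L →+* ℂ} {V : HermSpace3 L ι₁} {c : SeesawCtx L}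

/-- **the `hlevel` input of #CA1/#CA12–#CA15 HOLDS for every adelic side `S` and every level `Γ₀`** (at `K := Γ₀.K`): it is the first two
conjuncts of theta-3's pin lemma `ThetaAdelicSide.exists_corrector_of_mem_levelImage` (field (L3) `rat_split_level` read through
`exists_toBall_eq_of_mem_levelImage`, `Model/ThetaSpaceInputPin`). -/
theorem hlevel_of_side (S : ThetaAdelicSide V c) (Γ₀ : Level V) (hV : IsAnisotropic L V.Hm) :
    ∀ δ ∈ levelImage hHD hI h₁ h₃ Γ₀ hV, ∃ x : (V.latticeModel printFact_unitaryCompact_holds).G,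
      x ∈ (satLevelRegimeOf V hV Γ₀.K : Subgroup (V.latticeModel printFact_unitaryCompact_holds).G) ∧
        S.ιinf δ * x ∈ (V.latticeModel printFact_unitaryCompact_holds).Γ := by
  intro δ hδ
  obtain ⟨x, hx, hΓ, -⟩ := ThetaAdelicSide.exists_corrector_of_mem_levelImage hHD hI h₁ h₃ S Γ₀ hV δ hδ
  exact ⟨x, hx, hΓ⟩

variable {hV : IsAnisotropic L V.Hm} {k : Fin 4} {N : ℕ}

/-- (REP) along one direction is invariant under transport of `C` along `S₁ = S₂` (companion of sinst-1's `isPMinusKilled_castSide_iff`). -/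
theorem ArchKTypeData.isPMinusKilledAlong_castSide_iff {S₁ S₂ : ThetaAdelicSide V c} (e : S₁ = S₂)
    (C : ArchKTypeData (thetaSpaceInputIn hHD hI h₁ h₃ S₁ hV) k N) (v : Fin 2 → ℂ) :
    (ArchKTypeData.castSide hHD hI h₁ h₃ e C).IsPMinusKilledAlong BallForms.expP v ↔ C.IsPMinusKilledAlong BallForms.expP v := by
  subst e; rfl

end Generic

/-! ## § 1 The pin families and the context -/

section SA

variable (hHD : exists_isReal_hodgeModel) (hI : hodgePQ_independent_of_hodgeModel)
  (h₁ : BallQuotientUniformised)  (h₃ : CMAbelianVarietyRealised)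

variable
  (hGR : ∀ {L : CMField} {ι₁ : L →+* ℂ} (V : HermSpace3 L ι₁) (c : SeesawCtx L),
    (cmSplittingDatum (L : Type) finProdFinEquiv (frameD V) (frameD_real V) (frameD_ne V) (dW c.D) (dW_real c.D)
      (dW_ne c.D)).CompatibleSplitting)
  (η : ∀ {L : CMField} {ι₁ : L →+* ℂ} (V : HermSpace3 L ι₁) (c : SeesawCtx L),
    CMAdelic (L : Type) (frameD V) × CMAdelic (L : Type) (dW c.D) →* ℂˣ)
  (hη : ∀ {L : CMField} {ι₁ : L →+* ℂ} (V : HermSpace3 L ι₁) (c : SeesawCtx L),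
    ∀ γU ∈ CMRat (L : Type) (frameD V), ∀ γ ∈ CMRat (L : Type) (dW c.D), η V c (γU, γ) = 1)
  (hηc : ∀ {L : CMField} {ι₁ : L →+* ℂ} (V : HermSpace3 L ι₁) (c : SeesawCtx L), Continuous fun p => ((η V c p : ℂˣ) : ℂ))
  (hGR₀ : ∀ {L : CMField} {ι₁ : L →+* ℂ} (V : HermSpace3 L ι₁) (c : SeesawCtx L),
    (cmSplittingDatum (L : Type) (e₁) (frameD V) (frameD_real V) (frameD_ne V) (lineVec (L : Type) (dW c.D 0))
      (fun _ => dW_real c.D 0) (fun _ => dW_ne c.D 0)).CompatibleSplitting)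
  (hGR₁ : ∀ {L : CMField} {ι₁ : L →+* ℂ} (V : HermSpace3 L ι₁) (c : SeesawCtx L),
    (cmSplittingDatum (L : Type) (e₁) (frameD V) (frameD_real V) (frameD_ne V) (lineVec (L : Type) (dW c.D 1))
      (fun _ => dW_real c.D 1) (fun _ => dW_ne c.D 1)).CompatibleSplitting)
  (hGR₂ : ∀ {L : CMField} {ι₁ : L →+* ℂ} (V : HermSpace3 L ι₁) (c : SeesawCtx L),
    (cmSplittingDatum (L : Type) (e₁) (frameD V) (frameD_real V) (frameD_ne V) (lineVec (L : Type) (dW' c.D 0))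
      (fun _ => dW'_real c.D 0) (fun _ => dW'_ne c.D 0)).CompatibleSplitting)
  (hGR₃ : ∀ {L : CMField} {ι₁ : L →+* ℂ} (V : HermSpace3 L ι₁) (c : SeesawCtx L),
    (cmSplittingDatum (L : Type) (e₁) (frameD V) (frameD_real V) (frameD_ne V) (lineVec (L : Type) (dW' c.D 1))
      (fun _ => dW'_real c.D 1) (fun _ => dW'_ne c.D 1)).CompatibleSplitting)
  (μ : ∀ {L : CMField}, SeesawCtx L → Fin 4 → NumberField.InfinitePlace L → ℤ)
  (𝔄 : ∀ {L : CMField} {ι₁ : L →+* ℂ} (V : HermSpace3 L ι₁) (c : SeesawCtx L),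
    ArchLineDatum V c.D (hGR V c) (hGR₀ V c) (hGR₁ V c) (hGR₂ V c) (hGR₃ V c) (η V c) (μ c))

variable {L : CMField} {ι₁ : L →+* ℂ} (V : HermSpace3 L ι₁) (c : SeesawCtx L) (hV : IsAnisotropic L V.Hm)

/-- at a good context of the oriented bit, at the canonical representative, **line 0 reads positive at `v₁`**. -/
theorem hpos_dW₀_SA (hemb : (InfinitePlace.mk ι₁).embedding = ι₁) (hc : SignRecipe.GoodCtx (orientBitι L ι₁) ι₁ c) :
    0 < cmXW (L : Type) (frameD V) (lineVec (L : Type) (dW c.D 0)) (fun _ => dW_real c.D 0) ι₁ (HypCensus.cmPlace (L : Type) ι₁) 0 :=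
  (hpos_iff_eq_orientBitι_of_goodCtx_of_embedding_eq V hemb hc 0 (dW_real c.D 0)).2 rfl

/-- … and so does line 1. -/
theorem hpos_dW₁_SA (hemb : (InfinitePlace.mk ι₁).embedding = ι₁) (hc : SignRecipe.GoodCtx (orientBitι L ι₁) ι₁ c) :
    0 < cmXW (L : Type) (frameD V) (lineVec (L : Type) (dW c.D 1)) (fun _ => dW_real c.D 1) ι₁ (HypCensus.cmPlace (L : Type) ι₁) 0 :=
  (hpos_iff_eq_orientBitι_of_goodCtx_of_embedding_eq V hemb hc 1 (dW_real c.D 1)).2 rfl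

/-- the plane `⟨a₀, a₁⟩` is definite at `ι₁` (sinst-1 `dW_definite_of_goodCtx`, restated at the oriented bit). -/
theorem h₁W_SA (hc : SignRecipe.GoodCtx (orientBitι L ι₁) ι₁ c) : (∀ j, 0 < (ι₁ (dW c.D j)).re) ∨ ∀ j, (ι₁ (dW c.D j)).re < 0 :=
  dW_definite_of_goodCtx ι₁ c (orientBitι L ι₁) hc

/-! ## § 2 Line 0 -/

section Zero

variable (hemb : (InfinitePlace.mk ι₁).embedding = ι₁) (hc : SignRecipe.GoodCtx (orientBitι L ι₁) ι₁ c) (N : ℕ) (Γ₀ : Level V)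
  (arch₀ : linePhi V (dW c.D 0) (dW_real c.D 0) (dW_ne c.D 0) (hpos_dW₀_SA V c hemb hc) = (𝔄 V c).Φinf 0)
  (harch : ∀ a : UnitaryGroup.arch (↥(maximalRealSubfield L)) L (IsCMField.complexConj L) 3 V.Hm,
    UnitaryGroup.archAt (↥(maximalRealSubfield L)) L (IsCMField.complexConj L) 3 V.Hm (UnitaryGroup.cmPlace (L : Type) ι₁)
        (NumberField.complexConj_smul_infinitePlace (L : Type) _) (IsCMField.complexConj_ne_one (L : Type)) a = 1 →
    ∀ ℓ, lineRepD V c.D (hGR V c) (hGR₀ V c) (hGR₁ V c) (hGR₂ V c) (hGR₃ V c) (η V c) 0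
        (HodgeCM.Adelic.regimeEquiv L V.Hm hV
          (UnitaryGroup.archToAdelic (↥(maximalRealSubfield L)) L (IsCMField.complexConj L) 3 V.Hm a), 1)
        (testFun (↥(maximalRealSubfield L)) (Fin 3)
          (blockFamilyOfAt (L : Type) e₁ (frameD V) (frameD_real V) (frameD_ne V) (lineVec (L : Type) (dW c.D 0))
            (fun _ => dW_real c.D 0) (fun _ => dW_ne c.D 0) ι₁ (blockPosEquiv V) (blockNegEquiv V)
            (posIdxEquivUnit (hpos_dW₀_SA V c hemb hc)) (negIdxEquivEmpty (hpos_dW₀_SA V c hemb hc)) (degOnePDual Empty) (binvPi 1) ℓ)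
          ((𝔄 V c).x₀ 0) N) =
      testFun (↥(maximalRealSubfield L)) (Fin 3)
        (blockFamilyOfAt (L : Type) e₁ (frameD V) (frameD_real V) (frameD_ne V) (lineVec (L : Type) (dW c.D 0))
          (fun _ => dW_real c.D 0) (fun _ => dW_ne c.D 0) ι₁ (blockPosEquiv V) (blockNegEquiv V)
          (posIdxEquivUnit (hpos_dW₀_SA V c hemb hc)) (negIdxEquivEmpty (hpos_dW₀_SA V c hemb hc)) (degOnePDual Empty) (binvPi 1) ℓ)
        ((𝔄 V c).x₀ 0) N)
  (hfin : ∀ kf : UnitaryGroup.finAdelic (↥(maximalRealSubfield L)) L (IsCMField.complexConj L) 3 V.Hm, kf ∈ Γ₀.K →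
    ∀ Φinf : 𝓢((Fin 3 → mixedSpace (↥(maximalRealSubfield L))), ℂ),
      lineRepD V c.D (hGR V c) (hGR₀ V c) (hGR₁ V c) (hGR₂ V c) (hGR₃ V c) (η V c) 0
          (HodgeCM.Adelic.regimeEquiv L V.Hm hV
            (UnitaryGroup.finAdelicToAdelic (↥(maximalRealSubfield L)) L (IsCMField.complexConj L) 3 V.Hm kf), 1)
          (testFun (↥(maximalRealSubfield L)) (Fin 3) Φinf ((𝔄 V c).x₀ 0) N) =
        testFun (↥(maximalRealSubfield L)) (Fin 3) Φinf ((𝔄 V c).x₀ 0) N)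
  (hχ : ∀ u : stabilizer U21 x₀,
    ((lineScalar_zero V c.D (hGR V c) (hGR₀ V c) (hGR₁ V c) (eta₀ V c.D (η V c)) (u : U21) : ℂˣ) : ℂ) *
        ((matA (stabilizerEquivK21.symm u)).det ^
            (lineVacExponentsZero V c (hGR₀ V c) (h₁W_SA c hc) (posIdxEquivUnit (hpos_dW₀_SA V c hemb hc))
              (negIdxEquivEmpty (hpos_dW₀_SA V c hemb hc))).eP *
          sclD (stabilizerEquivK21.symm u) ^
            (lineVacExponentsZero V c (hGR₀ V c) (h₁W_SA c hc) (posIdxEquivUnit (hpos_dW₀_SA V c hemb hc))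
              (negIdxEquivEmpty (hpos_dW₀_SA V c hemb hc))).eQ) =
      star (sclD (stabilizerEquivK21.symm u)))

/-- line 0 of E's `C` at period-1's term with the composed line inputs (before transport): #CA14 `archKTypeOfSlotZeroRec` with
`hlevel`/`hsec` DISCHARGED and the slot data of a positive line. -/
def archKTypeOfSAZero' :
    ArchKTypeData (thetaSpaceInputIn hHD hI h₁ h₃
      (archSideOf V c (hGR V c) (hGR₀ V c) (hGR₁ V c) (hGR₂ V c) (hGR₃ V c) (η V c) (hη V c) (hηc V c) (h₁W_SA c hc)
        (fun k => archLineInputOf (𝔄 V c) k)) hV) 0 N :=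
  archKTypeOfSlotZeroRec hHD hI h₁ h₃ V c (hGR V c) (hGR₀ V c) (hGR₁ V c) (hGR₂ V c) (hGR₃ V c) (η V c) (hη V c) (hηc V c)
    (h₁W_SA c hc) (fun k => archLineInputOf (𝔄 V c) k) hV N Γ₀
    (hlevel_of_side hHD hI h₁ h₃ _ Γ₀ hV) (binvPi 1)
    (posIdxEquivUnit (hpos_dW₀_SA V c hemb hc)) (negIdxEquivEmpty (hpos_dW₀_SA V c hemb hc))
    (dotProductEquiv ℂ (Fin 2) (Pi.single 0 1)) arch₀ harch hfin
    (hsec_of_embedding_eq V (lineVec (L : Type) (dW c.D 0)) (fun _ => dW_real c.D 0) (fun _ => dW_ne c.D 0) _ _ hemb) hχ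

/-- **LINE 0 OF E's `C` AT `SA`** (canonical representative, good context of the oriented bit). -/
def archKTypeOfSAZero :
    ArchKTypeData (thetaSpaceInputIn hHD hI h₁ h₃ (SInstance.SA @hGR @η @hη @hηc @hGR₀ @hGR₁ @hGR₂ @hGR₃ @μ @𝔄 V c) hV) 0 N :=
  ArchKTypeData.castSide hHD hI h₁ h₃
    (SInstance.SA_eq_archSideOf_of_goodCtx @hGR @η @hη @hηc @hGR₀ @hGR₁ @hGR₂ @hGR₃ @μ @𝔄 V c (orientBitι L ι₁) hc).symm
    (archKTypeOfSAZero' hHD hI h₁ h₃ hGR η hη hηc hGR₀ hGR₁ hGR₂ hGR₃ μ 𝔄 V c hV hemb hc N Γ₀ arch₀ harch hfin hχ)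

/-- **ROW 14 for line 0 at `SA` — no further hypothesis.** -/
theorem isWeaklyPDiff_archKTypeOfSAZero :
    (archKTypeOfSAZero hHD hI h₁ h₃ hGR η hη hηc hGR₀ hGR₁ hGR₂ hGR₃ μ 𝔄 V c hV hemb hc N Γ₀ arch₀ harch hfin hχ).IsWeaklyPDiff
      BallForms.expP := by
  rw [archKTypeOfSAZero, ArchKTypeData.isWeaklyPDiff_castSide_iff]
  exact isWeaklyPDiff_archKTypeOfSlotZeroRec hHD hI h₁ h₃ V c (hGR V c) (hGR₀ V c) (hGR₁ V c) (hGR₂ V c) (hGR₃ V c) (η V c)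
    (hη V c) (hηc V c) (h₁W_SA c hc) (fun k => archLineInputOf (𝔄 V c) k) hV N Γ₀ (hlevel_of_side hHD hI h₁ h₃ _ Γ₀ hV) (binvPi 1)
    (posIdxEquivUnit (hpos_dW₀_SA V c hemb hc)) (negIdxEquivEmpty (hpos_dW₀_SA V c hemb hc)) (dotProductEquiv ℂ (Fin 2) (Pi.single 0 1))
    arch₀ harch hfin (hsec_of_embedding_eq V (lineVec (L : Type) (dW c.D 0)) (fun _ => dW_real c.D 0) (fun _ => dW_ne c.D 0) _ _ hemb) hχ

/-- **ROW 15 for line 0 at `SA` along `expP` itself (Along shape of `_r20AE`) — no further hypothesis.** -/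
theorem isPMinusKilledAlong_archKTypeOfSAZero (p : Fin 2) :
    (archKTypeOfSAZero hHD hI h₁ h₃ hGR η hη hηc hGR₀ hGR₁ hGR₂ hGR₃ μ 𝔄 V c hV hemb hc N Γ₀ arch₀ harch hfin hχ).IsPMinusKilledAlong
      BallForms.expP (-Complex.I • (Pi.single p 1 : Fin 2 → ℂ)) := by
  rw [archKTypeOfSAZero, ArchKTypeData.isPMinusKilledAlong_castSide_iff]
  exact isPMinusKilledAlong_archKTypeOfSlotZeroRec_of_embedding_eq hHD hI h₁ h₃ V c (hGR V c) (hGR₀ V c) (hGR₁ V c) (hGR₂ V c)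
    (hGR₃ V c) (η V c) (hη V c) (hηc V c) (h₁W_SA c hc) (fun k => archLineInputOf (𝔄 V c) k) hV N Γ₀
    (hlevel_of_side hHD hI h₁ h₃ _ Γ₀ hV) (binvPi 1) (posIdxEquivUnit (hpos_dW₀_SA V c hemb hc))
    (negIdxEquivEmpty (hpos_dW₀_SA V c hemb hc)) (dotProductEquiv ℂ (Fin 2) (Pi.single 0 1)) arch₀ harch hfin
    (hsec_of_embedding_eq V (lineVec (L : Type) (dW c.D 0)) (fun _ => dW_real c.D 0) (fun _ => dW_ne c.D 0) _ _ hemb) hχ hemb p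

end Zero

/-! ## § 3 Line 1 -/

section One

variable (hemb : (InfinitePlace.mk ι₁).embedding = ι₁) (hc : SignRecipe.GoodCtx (orientBitι L ι₁) ι₁ c) (N : ℕ) (Γ₀ : Level V)
  (arch₀ : linePhi V (dW c.D 1) (dW_real c.D 1) (dW_ne c.D 1) (hpos_dW₁_SA V c hemb hc) = (𝔄 V c).Φinf 1)
  (harch : ∀ a : UnitaryGroup.arch (↥(maximalRealSubfield L)) L (IsCMField.complexConj L) 3 V.Hm,
    UnitaryGroup.archAt (↥(maximalRealSubfield L)) L (IsCMField.complexConj L) 3 V.Hm (UnitaryGroup.cmPlace (L : Type) ι₁)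
        (NumberField.complexConj_smul_infinitePlace (L : Type) _) (IsCMField.complexConj_ne_one (L : Type)) a = 1 →
    ∀ ℓ, lineRepD V c.D (hGR V c) (hGR₀ V c) (hGR₁ V c) (hGR₂ V c) (hGR₃ V c) (η V c) 1
        (HodgeCM.Adelic.regimeEquiv L V.Hm hV
          (UnitaryGroup.archToAdelic (↥(maximalRealSubfield L)) L (IsCMField.complexConj L) 3 V.Hm a), 1)
        (testFun (↥(maximalRealSubfield L)) (Fin 3)
          (blockFamilyOfAt (L : Type) e₁ (frameD V) (frameD_real V) (frameD_ne V) (lineVec (L : Type) (dW c.D 1))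
            (fun _ => dW_real c.D 1) (fun _ => dW_ne c.D 1) ι₁ (blockPosEquiv V) (blockNegEquiv V)
            (posIdxEquivUnit (hpos_dW₁_SA V c hemb hc)) (negIdxEquivEmpty (hpos_dW₁_SA V c hemb hc)) (degOnePDual Empty) (binvPi 1) ℓ)
          ((𝔄 V c).x₀ 1) N) =
      testFun (↥(maximalRealSubfield L)) (Fin 3)
        (blockFamilyOfAt (L : Type) e₁ (frameD V) (frameD_real V) (frameD_ne V) (lineVec (L : Type) (dW c.D 1))
          (fun _ => dW_real c.D 1) (fun _ => dW_ne c.D 1) ι₁ (blockPosEquiv V) (blockNegEquiv V)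
          (posIdxEquivUnit (hpos_dW₁_SA V c hemb hc)) (negIdxEquivEmpty (hpos_dW₁_SA V c hemb hc)) (degOnePDual Empty) (binvPi 1) ℓ)
        ((𝔄 V c).x₀ 1) N)
  (hfin : ∀ kf : UnitaryGroup.finAdelic (↥(maximalRealSubfield L)) L (IsCMField.complexConj L) 3 V.Hm, kf ∈ Γ₀.K →
    ∀ Φinf : 𝓢((Fin 3 → mixedSpace (↥(maximalRealSubfield L))), ℂ),
      lineRepD V c.D (hGR V c) (hGR₀ V c) (hGR₁ V c) (hGR₂ V c) (hGR₃ V c) (η V c) 1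
          (HodgeCM.Adelic.regimeEquiv L V.Hm hV
            (UnitaryGroup.finAdelicToAdelic (↥(maximalRealSubfield L)) L (IsCMField.complexConj L) 3 V.Hm kf), 1)
          (testFun (↥(maximalRealSubfield L)) (Fin 3) Φinf ((𝔄 V c).x₀ 1) N) =
        testFun (↥(maximalRealSubfield L)) (Fin 3) Φinf ((𝔄 V c).x₀ 1) N)
  (hχ : ∀ u : stabilizer U21 x₀,
    ((lineScalar_one V c.D (hGR V c) (hGR₀ V c) (hGR₁ V c) (eta₁ V c.D (η V c)) (u : U21) : ℂˣ) : ℂ) *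
        ((matA (stabilizerEquivK21.symm u)).det ^
            (lineVacExponentsOne V c (hGR₁ V c) (h₁W_SA c hc) (posIdxEquivUnit (hpos_dW₁_SA V c hemb hc))
              (negIdxEquivEmpty (hpos_dW₁_SA V c hemb hc))).eP *
          sclD (stabilizerEquivK21.symm u) ^
            (lineVacExponentsOne V c (hGR₁ V c) (h₁W_SA c hc) (posIdxEquivUnit (hpos_dW₁_SA V c hemb hc))
              (negIdxEquivEmpty (hpos_dW₁_SA V c hemb hc))).eQ) =
      star (sclD (stabilizerEquivK21.symm u)))

/-- line 1 of E's `C` at period-1's term with the composed line inputs (before transport): #CA14 `archKTypeOfSlotOneRec` with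
`hlevel`/`hsec` DISCHARGED and the slot data of a positive line. -/
def archKTypeOfSAOne' :
    ArchKTypeData (thetaSpaceInputIn hHD hI h₁ h₃
      (archSideOf V c (hGR V c) (hGR₀ V c) (hGR₁ V c) (hGR₂ V c) (hGR₃ V c) (η V c) (hη V c) (hηc V c) (h₁W_SA c hc)
        (fun k => archLineInputOf (𝔄 V c) k)) hV) 1 N :=
  archKTypeOfSlotOneRec hHD hI h₁ h₃ V c (hGR V c) (hGR₀ V c) (hGR₁ V c) (hGR₂ V c) (hGR₃ V c) (η V c) (hη V c) (hηc V c)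
    (h₁W_SA c hc) (fun k => archLineInputOf (𝔄 V c) k) hV N Γ₀
    (hlevel_of_side hHD hI h₁ h₃ _ Γ₀ hV) (binvPi 1)
    (posIdxEquivUnit (hpos_dW₁_SA V c hemb hc)) (negIdxEquivEmpty (hpos_dW₁_SA V c hemb hc))
    (dotProductEquiv ℂ (Fin 2) (Pi.single 0 1)) arch₀ harch hfin
    (hsec_of_embedding_eq V (lineVec (L : Type) (dW c.D 1)) (fun _ => dW_real c.D 1) (fun _ => dW_ne c.D 1) _ _ hemb) hχ

/-- **LINE 1 OF E's `C` AT `SA`** (canonical representative, good context of the oriented bit). -/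
def archKTypeOfSAOne :
    ArchKTypeData (thetaSpaceInputIn hHD hI h₁ h₃ (SInstance.SA @hGR @η @hη @hηc @hGR₀ @hGR₁ @hGR₂ @hGR₃ @μ @𝔄 V c) hV) 1 N :=
  ArchKTypeData.castSide hHD hI h₁ h₃
    (SInstance.SA_eq_archSideOf_of_goodCtx @hGR @η @hη @hηc @hGR₀ @hGR₁ @hGR₂ @hGR₃ @μ @𝔄 V c (orientBitι L ι₁) hc).symm
    (archKTypeOfSAOne' hHD hI h₁ h₃ hGR η hη hηc hGR₀ hGR₁ hGR₂ hGR₃ μ 𝔄 V c hV hemb hc N Γ₀ arch₀ harch hfin hχ)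

/-- **ROW 14 for line 1 at `SA` — no further hypothesis.** -/
theorem isWeaklyPDiff_archKTypeOfSAOne :
    (archKTypeOfSAOne hHD hI h₁ h₃ hGR η hη hηc hGR₀ hGR₁ hGR₂ hGR₃ μ 𝔄 V c hV hemb hc N Γ₀ arch₀ harch hfin hχ).IsWeaklyPDiff
      BallForms.expP := by
  rw [archKTypeOfSAOne, ArchKTypeData.isWeaklyPDiff_castSide_iff]
  exact isWeaklyPDiff_archKTypeOfSlotOneRec hHD hI h₁ h₃ V c (hGR V c) (hGR₀ V c) (hGR₁ V c) (hGR₂ V c) (hGR₃ V c) (η V c)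
    (hη V c) (hηc V c) (h₁W_SA c hc) (fun k => archLineInputOf (𝔄 V c) k) hV N Γ₀ (hlevel_of_side hHD hI h₁ h₃ _ Γ₀ hV) (binvPi 1)
    (posIdxEquivUnit (hpos_dW₁_SA V c hemb hc)) (negIdxEquivEmpty (hpos_dW₁_SA V c hemb hc)) (dotProductEquiv ℂ (Fin 2) (Pi.single 0 1))
    arch₀ harch hfin (hsec_of_embedding_eq V (lineVec (L : Type) (dW c.D 1)) (fun _ => dW_real c.D 1) (fun _ => dW_ne c.D 1) _ _ hemb) hχ

/-- **ROW 15 for line 1 at `SA` along `expP` itself (Along shape of `_r20AE`) — no further hypothesis.** -/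
theorem isPMinusKilledAlong_archKTypeOfSAOne (p : Fin 2) :
    (archKTypeOfSAOne hHD hI h₁ h₃ hGR η hη hηc hGR₀ hGR₁ hGR₂ hGR₃ μ 𝔄 V c hV hemb hc N Γ₀ arch₀ harch hfin hχ).IsPMinusKilledAlong
      BallForms.expP (-Complex.I • (Pi.single p 1 : Fin 2 → ℂ)) := by
  rw [archKTypeOfSAOne, ArchKTypeData.isPMinusKilledAlong_castSide_iff]
  exact isPMinusKilledAlong_archKTypeOfSlotOneRec_of_embedding_eq hHD hI h₁ h₃ V c (hGR V c) (hGR₀ V c) (hGR₁ V c) (hGR₂ V c)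
    (hGR₃ V c) (η V c) (hη V c) (hηc V c) (h₁W_SA c hc) (fun k => archLineInputOf (𝔄 V c) k) hV N Γ₀
    (hlevel_of_side hHD hI h₁ h₃ _ Γ₀ hV) (binvPi 1) (posIdxEquivUnit (hpos_dW₁_SA V c hemb hc))
    (negIdxEquivEmpty (hpos_dW₁_SA V c hemb hc)) (dotProductEquiv ℂ (Fin 2) (Pi.single 0 1)) arch₀ harch hfin
    (hsec_of_embedding_eq V (lineVec (L : Type) (dW c.D 1)) (fun _ => dW_real c.D 1) (fun _ => dW_ne c.D 1) _ _ hemb) hχ hemb p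

end One

/-! ## § 4 E's binder shape at `SA`: the `k`-dispatch, rows 14/15 dispatched -/

section Dispatch

variable (hemb : (InfinitePlace.mk ι₁).embedding = ι₁) (hc : SignRecipe.GoodCtx (orientBitι L ι₁) ι₁ c) (N : ℕ) (Γ₀ : Level V)

variable
  (arch₀₀ : linePhi V (dW c.D 0) (dW_real c.D 0) (dW_ne c.D 0) (hpos_dW₀_SA V c hemb hc) = (𝔄 V c).Φinf 0)
  (harch₀ : ∀ a : UnitaryGroup.arch (↥(maximalRealSubfield L)) L (IsCMField.complexConj L) 3 V.Hm,
    UnitaryGroup.archAt (↥(maximalRealSubfield L)) L (IsCMField.complexConj L) 3 V.Hm (UnitaryGroup.cmPlace (L : Type) ι₁)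
        (NumberField.complexConj_smul_infinitePlace (L : Type) _) (IsCMField.complexConj_ne_one (L : Type)) a = 1 →
    ∀ ℓ, lineRepD V c.D (hGR V c) (hGR₀ V c) (hGR₁ V c) (hGR₂ V c) (hGR₃ V c) (η V c) 0
        (HodgeCM.Adelic.regimeEquiv L V.Hm hV
          (UnitaryGroup.archToAdelic (↥(maximalRealSubfield L)) L (IsCMField.complexConj L) 3 V.Hm a), 1)
        (testFun (↥(maximalRealSubfield L)) (Fin 3)
          (blockFamilyOfAt (L : Type) e₁ (frameD V) (frameD_real V) (frameD_ne V) (lineVec (L : Type) (dW c.D 0))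
            (fun _ => dW_real c.D 0) (fun _ => dW_ne c.D 0) ι₁ (blockPosEquiv V) (blockNegEquiv V)
            (posIdxEquivUnit (hpos_dW₀_SA V c hemb hc)) (negIdxEquivEmpty (hpos_dW₀_SA V c hemb hc)) (degOnePDual Empty) (binvPi 1) ℓ)
          ((𝔄 V c).x₀ 0) N) =
      testFun (↥(maximalRealSubfield L)) (Fin 3)
        (blockFamilyOfAt (L : Type) e₁ (frameD V) (frameD_real V) (frameD_ne V) (lineVec (L : Type) (dW c.D 0))
          (fun _ => dW_real c.D 0) (fun _ => dW_ne c.D 0) ι₁ (blockPosEquiv V) (blockNegEquiv V)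
          (posIdxEquivUnit (hpos_dW₀_SA V c hemb hc)) (negIdxEquivEmpty (hpos_dW₀_SA V c hemb hc)) (degOnePDual Empty) (binvPi 1) ℓ)
        ((𝔄 V c).x₀ 0) N)
  (hfin₀ : ∀ kf : UnitaryGroup.finAdelic (↥(maximalRealSubfield L)) L (IsCMField.complexConj L) 3 V.Hm, kf ∈ Γ₀.K →
    ∀ Φinf : 𝓢((Fin 3 → mixedSpace (↥(maximalRealSubfield L))), ℂ),
      lineRepD V c.D (hGR V c) (hGR₀ V c) (hGR₁ V c) (hGR₂ V c) (hGR₃ V c) (η V c) 0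
          (HodgeCM.Adelic.regimeEquiv L V.Hm hV
            (UnitaryGroup.finAdelicToAdelic (↥(maximalRealSubfield L)) L (IsCMField.complexConj L) 3 V.Hm kf), 1)
          (testFun (↥(maximalRealSubfield L)) (Fin 3) Φinf ((𝔄 V c).x₀ 0) N) =
        testFun (↥(maximalRealSubfield L)) (Fin 3) Φinf ((𝔄 V c).x₀ 0) N)
  (hχ₀ : ∀ u : stabilizer U21 x₀,
    ((lineScalar_zero V c.D (hGR V c) (hGR₀ V c) (hGR₁ V c) (eta₀ V c.D (η V c)) (u : U21) : ℂˣ) : ℂ) *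
        ((matA (stabilizerEquivK21.symm u)).det ^
            (lineVacExponentsZero V c (hGR₀ V c) (h₁W_SA c hc) (posIdxEquivUnit (hpos_dW₀_SA V c hemb hc))
              (negIdxEquivEmpty (hpos_dW₀_SA V c hemb hc))).eP *
          sclD (stabilizerEquivK21.symm u) ^
            (lineVacExponentsZero V c (hGR₀ V c) (h₁W_SA c hc) (posIdxEquivUnit (hpos_dW₀_SA V c hemb hc))
              (negIdxEquivEmpty (hpos_dW₀_SA V c hemb hc))).eQ) =
      star (sclD (stabilizerEquivK21.symm u)))
  (arch₀₁ : linePhi V (dW c.D 1) (dW_real c.D 1) (dW_ne c.D 1) (hpos_dW₁_SA V c hemb hc) = (𝔄 V c).Φinf 1)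
  (harch₁ : ∀ a : UnitaryGroup.arch (↥(maximalRealSubfield L)) L (IsCMField.complexConj L) 3 V.Hm,
    UnitaryGroup.archAt (↥(maximalRealSubfield L)) L (IsCMField.complexConj L) 3 V.Hm (UnitaryGroup.cmPlace (L : Type) ι₁)
        (NumberField.complexConj_smul_infinitePlace (L : Type) _) (IsCMField.complexConj_ne_one (L : Type)) a = 1 →
    ∀ ℓ, lineRepD V c.D (hGR V c) (hGR₀ V c) (hGR₁ V c) (hGR₂ V c) (hGR₃ V c) (η V c) 1
        (HodgeCM.Adelic.regimeEquiv L V.Hm hV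
          (UnitaryGroup.archToAdelic (↥(maximalRealSubfield L)) L (IsCMField.complexConj L) 3 V.Hm a), 1)
        (testFun (↥(maximalRealSubfield L)) (Fin 3)
          (blockFamilyOfAt (L : Type) e₁ (frameD V) (frameD_real V) (frameD_ne V) (lineVec (L : Type) (dW c.D 1))
            (fun _ => dW_real c.D 1) (fun _ => dW_ne c.D 1) ι₁ (blockPosEquiv V) (blockNegEquiv V)
            (posIdxEquivUnit (hpos_dW₁_SA V c hemb hc)) (negIdxEquivEmpty (hpos_dW₁_SA V c hemb hc)) (degOnePDual Empty) (binvPi 1) ℓ)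
          ((𝔄 V c).x₀ 1) N) =
      testFun (↥(maximalRealSubfield L)) (Fin 3)
        (blockFamilyOfAt (L : Type) e₁ (frameD V) (frameD_real V) (frameD_ne V) (lineVec (L : Type) (dW c.D 1))
          (fun _ => dW_real c.D 1) (fun _ => dW_ne c.D 1) ι₁ (blockPosEquiv V) (blockNegEquiv V)
          (posIdxEquivUnit (hpos_dW₁_SA V c hemb hc)) (negIdxEquivEmpty (hpos_dW₁_SA V c hemb hc)) (degOnePDual Empty) (binvPi 1) ℓ)
        ((𝔄 V c).x₀ 1) N)
  (hfin₁ : ∀ kf : UnitaryGroup.finAdelic (↥(maximalRealSubfield L)) L (IsCMField.complexConj L) 3 V.Hm, kf ∈ Γ₀.K →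
    ∀ Φinf : 𝓢((Fin 3 → mixedSpace (↥(maximalRealSubfield L))), ℂ),
      lineRepD V c.D (hGR V c) (hGR₀ V c) (hGR₁ V c) (hGR₂ V c) (hGR₃ V c) (η V c) 1
          (HodgeCM.Adelic.regimeEquiv L V.Hm hV
            (UnitaryGroup.finAdelicToAdelic (↥(maximalRealSubfield L)) L (IsCMField.complexConj L) 3 V.Hm kf), 1)
          (testFun (↥(maximalRealSubfield L)) (Fin 3) Φinf ((𝔄 V c).x₀ 1) N) =
        testFun (↥(maximalRealSubfield L)) (Fin 3) Φinf ((𝔄 V c).x₀ 1) N)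
  (hχ₁ : ∀ u : stabilizer U21 x₀,
    ((lineScalar_one V c.D (hGR V c) (hGR₀ V c) (hGR₁ V c) (eta₁ V c.D (η V c)) (u : U21) : ℂˣ) : ℂ) *
        ((matA (stabilizerEquivK21.symm u)).det ^
            (lineVacExponentsOne V c (hGR₁ V c) (h₁W_SA c hc) (posIdxEquivUnit (hpos_dW₁_SA V c hemb hc))
              (negIdxEquivEmpty (hpos_dW₁_SA V c hemb hc))).eP *
          sclD (stabilizerEquivK21.symm u) ^
            (lineVacExponentsOne V c (hGR₁ V c) (h₁W_SA c hc) (posIdxEquivUnit (hpos_dW₁_SA V c hemb hc))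
              (negIdxEquivEmpty (hpos_dW₁_SA V c hemb hc))).eQ) =
      star (sclD (stabilizerEquivK21.symm u)))

/-- **E's `C` at `SA`, `k`-dispatched** (`k = 0 ∨ k = 1`). -/
def archKTypeOfSA (k : Fin 4) (hk : k = 0 ∨ k = 1) :
    ArchKTypeData (thetaSpaceInputIn hHD hI h₁ h₃ (SInstance.SA @hGR @η @hη @hηc @hGR₀ @hGR₁ @hGR₂ @hGR₃ @μ @𝔄 V c) hV) k N :=
  if h0 : k = 0 then
    h0.symm ▸ archKTypeOfSAZero hHD hI h₁ h₃ hGR η hη hηc hGR₀ hGR₁ hGR₂ hGR₃ μ 𝔄 V c hV hemb hc N Γ₀ arch₀₀ harch₀ hfin₀ hχ₀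
  else
    (hk.resolve_left h0).symm ▸
      archKTypeOfSAOne hHD hI h₁ h₃ hGR η hη hηc hGR₀ hGR₁ hGR₂ hGR₃ μ 𝔄 V c hV hemb hc N Γ₀ arch₀₁ harch₁ hfin₁ hχ₁


-- port_pkg: scope closed for this part
end Dispatch
end SA
end HodgeCM.Model
end
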